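import Literature.Computability.AlgebraicComplexity.UniversalCircuit
import HarnessLib

/-!
# The universal circuit is defined over `ℤ` (Raz 2010; Forbes–Shpilka–Volk 2018, Thm. 12 —
# base-change form)

Topic `Literature/Computability/AlgebraicComplexity`; continues `UniversalCircuit.lean`
(`RazUniversal.exists_universalCircuit`: over every commutative semiring `R`, ONE polynomial
`U_R(x, y)` of size `poly(n, d, s)` specialises to every `f ∈ R[x₁, …, x_n]` of degree `≤ d` and
complexity `≤ s`). That statement hides `U_R` behind an existential, one ring at a time. This file
records the (routine, but used downstream) observation that the construction is **uniform in the
ring**: Raz's flattened universal circuit-graph `jointOut R σ r N` has coefficients `0, 1` and is the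
base change of `jointOut ℤ σ r N` along `ℤ → R` (`map_jointBase`, `map_jointOut`), hence there is ONE
integer polynomial `U ∈ ℤ[x, y]` of complexity `≤ 21877 (n+d+s+2)²⁶` such that for EVERY commutative
ring `R`, every `f ∈ R[x₁, …, x_n]` of total degree `≤ d` and complexity `≤ s` is a specialisation
`f = U_R(x, α)`, `U_R = map (ℤ → R) U`, of the label variables to constants of `R`
(`exists_universalCircuit_int`). Consumers: transfer arguments that move ONE circuit template
across several coefficient rings (products, quotients, fraction fields), e.g. the route file
`Summits/ValiantsHypothesis/ValiantsHypothesis/Theorems/TwoAdicLadderLadderOfVH*.lean`.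

The Lean text of `exists_universalCircuit_int` is adapted from `exists_universalCircuit`
(`UniversalCircuit.lean`, same construction `U = y₀ + Σ_{k=1}^{d} OUT_k(x, y_k)`); only the base-change
step is new. Honest framing: typed/proved literature infrastructure; `VP ≠ VNP` is NOT proved and
nothing here is progress on it.

## References

* [Raz2010] R. Raz, *Elusive functions and lower bounds for arithmetic circuits*, Theory Comput. 6
  (2010) 135–177, Prop. 2.8 (pp. 154–155), Prop. 3.3 (p. 158), §3.2 (p. 157: the labels are the only
  constants of the universal circuit).
* [ForbesShpilkaVolk2018] M. A. Forbes, A. Shpilka, B. L. Volk, *Succinct hitting sets and barriers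
  to proving lower bounds for algebraic circuits*, Theory Comput. 14 (2018), Thm. 12 (seq.) = ToC
  Thm. 3.1 (p. 19) ("Let `𝔽` be a field … there is a `poly(n,d,s)`-size algebraic circuit `U`").
* [Burgisser2000] P. Bürgisser, *Completeness and Reduction in Algebraic Complexity Theory* (2000),
  §4.1 (extension of scalars along a ring morphism).
-/

noncomputable section

namespace Literature.Computability.AlgebraicComplexity

open MvPolynomial

namespace RazUniversal

universe u v w

section Map

variable {R : Type u} [CommSemiring R] {R' : Type w} [CommSemiring R']
variable {σ : Type v} [Fintype σ] {r N : ℕ}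

/-- **The node polynomials of the universal circuit-graph are defined over `ℤ`**: every
`J_{d,b} ∈ R[Z ⊕ Y]` has coefficients `0, 1`, so a change of coefficients `φ : R → R'` maps
`J_{d,b}` over `R` to `J_{d,b}` over `R'` (induction on the level `d`, following Raz's recursion:
leaves are variables, a product slot multiplies two label-weighted sums of lower nodes).
[cite: Raz2010, Prop. 2.8 (pp. 154–155), §3.2 (p. 157)] -/
theorem map_jointBase (φ : R →+* R') :
    ∀ (n : ℕ) (d : Fin (r + 1)), (d : ℕ) = n → ∀ b : BIdx σ r N,
      MvPolynomial.map φ (jointBase (R := R) d b) = jointBase (R := R') d b := by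
  intro n
  induction n using Nat.strong_induction_on with
  | _ n ih =>
    intro d hd b
    rcases b with t | ⟨j, k⟩
    · rw [jointBase_inl, jointBase_inl]
      split_ifs
      · exact map_X φ _
      · exact map_zero _
    · by_cases h : 1 ≤ (j : ℕ) ∧ (j : ℕ) < (d : ℕ)
      · rw [jointBase_inr d j k h, jointBase_inr d j k h, map_mul, map_sum, map_sum]
        congr 1
        · refine Finset.sum_congr rfl fun b _ => ?_
          rw [map_mul, map_X, ih (j : ℕ) (by omega) (Fin.castSucc j) (by simp) b]
        · refine Finset.sum_congr rfl fun b _ => ?_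
          rw [map_mul, map_X,
            ih ((d : ℕ) - j) (by omega) ⟨(d : ℕ) - j, by have := d.isLt; omega⟩ rfl b]
      · rw [jointBase_inr_of_not d j k h, jointBase_inr_of_not d j k h, map_zero]

/-- **Raz's flattened universal circuit-graph `OUT ∈ R[Z ⊕ Y]` is defined over `ℤ`**: a change of
coefficients `φ : R → R'` maps `OUT` over `R` to `OUT` over `R'` (its only constants are the edge
labels, which are variables here). [cite: Raz2010, Prop. 2.8 (p. 154), §3.2 (p. 157)] -/
theorem map_jointOut (φ : R →+* R') :
    MvPolynomial.map φ (jointOut R σ r N) = jointOut R' σ r N := by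
  rw [jointOut_eq, jointOut_eq, map_sum]
  refine Finset.sum_congr rfl fun b _ => ?_
  rw [map_mul, map_X, map_jointBase φ r (Fin.last r) rfl b]

end Map

section Universal

/-- The total degree of a symbol is `≤ 1` over any commutative semiring (twin of the private
lemma of `UniversalCircuit.lean`). [folklore] -/
private theorem totalDegree_X_le_one' {A : Type u} [CommSemiring A] {Z : Type*} (v : Z) :
    (X v : MvPolynomial Z A).totalDegree ≤ 1 := by
  classical
  by_cases h1 : (1 : A) = 0
  · have h0 : (X v : MvPolynomial Z A) = 0 := by
      show monomial (Finsupp.single v 1) (1 : A) = 0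
      rw [h1, monomial_zero]
    rw [h0, totalDegree_zero]
    exact Nat.zero_le _
  · haveI : Nontrivial A := nontrivial_of_ne 1 0 h1
    rw [totalDegree_X]

/-- Arithmetic for the universal circuit (twin of the private `universal_aux_le` of
`UniversalCircuit.lean`): with `T = n + d + s + 2`, `n + (k+1) + 4 (d+2)² s (d+1)² + 1 ≤ 5 T⁵` for
`k < d`. [folklore] -/
private theorem universal_aux_le' {n s d k : ℕ} (hk : k < d) :
    n + (k + 1) + 4 * ((d + 2) ^ 2 * s) * (d + 1) ^ 2 + 1 ≤ 5 * (n + d + s + 2) ^ 5 := by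
  set T := n + d + s + 2 with hT
  have h1 : 1 ≤ T := by omega
  have hd2 : d + 2 ≤ T := by omega
  have hd1 : d + 1 ≤ T := by omega
  have hs : s ≤ T := by omega
  have hW : 4 * ((d + 2) ^ 2 * s) * (d + 1) ^ 2 ≤ 4 * T ^ 5 := by
    calc 4 * ((d + 2) ^ 2 * s) * (d + 1) ^ 2 ≤ 4 * (T ^ 2 * T) * T ^ 2 := by gcongr
      _ = 4 * T ^ 5 := by ring
  have hT5 : T ≤ T ^ 5 := Nat.le_self_pow (by norm_num) T
  have hnk : n + (k + 1) + 1 ≤ T := by omega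
  omega

/-- **The universal circuit over `ℤ` (Raz 2010; Forbes–Shpilka–Volk 2018, Thm. 12 — base-change
form).** For all `n, s, d` there are `p ≤ 9376 (n+d+s+2)²⁶` parameters and ONE integer polynomial
`U ∈ ℤ[x₁,…,x_n, y₁,…,y_p]` of circuit size `≤ 21877 (n+d+s+2)²⁶` (hence of size at most that over
every ring, `complexity_map_le`), every monomial of which has degree `≤ d` in the `x`-variables, of
total degree `≤ 3d + 1`, such that for EVERY commutative ring `R` every `f ∈ R[x₁,…,x_n]` of total
degree `≤ d` and complexity `≤ s` over `R` is a specialisation `f = U_R(x, α)` of the `y`-variables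
of `U_R := map (ℤ → R) U` to constants `α ∈ R^p`. Same construction as `exists_universalCircuit`
(`U = y₀ + Σ_{k=1}^{d} OUT_k(x, y_k)`), whose per-ring universality is transported along
`map_jointOut`. The printed uniformity clause ("constructible in time `poly(n,d,s)`") is not
formalised. [cite: ForbesShpilkaVolk2018, Thm. 12 (seq.) = ToC Thm. 3.1; Raz2010, Prop. 3.3 (p. 158)] -/
theorem exists_universalCircuit_int (n s d : ℕ) :
    ∃ (p : ℕ) (U : MvPolynomial (Fin n ⊕ Fin p) ℤ),
      p ≤ 9376 * (n + d + s + 2) ^ 26 ∧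
      complexity U ≤ 21877 * (n + d + s + 2) ^ 26 ∧
      (∀ e ∈ U.support, ∑ i : Fin n, e (Sum.inl i) ≤ d) ∧
      U.totalDegree ≤ 3 * d + 1 ∧
      ∀ (R : Type u) [CommRing R] (f : MvPolynomial (Fin n) R),
        f.totalDegree ≤ d → complexity f ≤ s →
          ∃ α : Fin p → R,
            aeval (Sum.elim X fun j => C (α j)) (MvPolynomial.map (Int.castRingHom R) U) = f := by
  -- adapted from `RazUniversal.exists_universalCircuit` (UniversalCircuit.lean), construction over ℤ
  classical
  set s' := (d + 2) ^ 2 * s with hs'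
  set W := 4 * s' * (d + 1) ^ 2 with hW
  obtain ⟨T, hT⟩ : ∃ T, n + d + s + 2 = T := ⟨_, rfl⟩
  rw [hT]
  let L : Fin d → Type := fun k => Lab (Fin n) ((k : ℕ) + 1) W
  let P := Unit ⊕ (Σ k : Fin d, L k)
  let e := Fintype.equivFin P
  let ι : ∀ k : Fin d, Fin n ⊕ L k → Fin n ⊕ Fin (Fintype.card P) := fun k =>
    Sum.map id fun l => e (Sum.inr ⟨k, l⟩)
  have hinj : ∀ k, Function.Injective (ι k) := fun k =>
    Sum.map_injective.2 ⟨fun _ _ h => h,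
      fun a b h => sigma_mk_injective (Sum.inr_injective (e.injective h))⟩
  -- the construction over an arbitrary commutative semiring `A`
  let J : ∀ (A : Type u) [CommSemiring A], Fin d → MvPolynomial (Fin n ⊕ Fin (Fintype.card P)) A :=
    fun A _ k => rename (ι k) (jointOut A (Fin n) ((k : ℕ) + 1) W)
  let UA : ∀ (A : Type u) [CommSemiring A], MvPolynomial (Fin n ⊕ Fin (Fintype.card P)) A :=
    fun A _ => X (Sum.inr (e (Sum.inl ()))) + ∑ k, J A k
  let JZ : Fin d → MvPolynomial (Fin n ⊕ Fin (Fintype.card P)) ℤ :=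
    fun k => rename (ι k) (jointOut ℤ (Fin n) ((k : ℕ) + 1) W)
  let U : MvPolynomial (Fin n ⊕ Fin (Fintype.card P)) ℤ := X (Sum.inr (e (Sum.inl ()))) + ∑ k, JZ k
  -- base change: `map (ℤ → A) U = U_A`
  have hmapU : ∀ (A : Type u) [CommRing A], MvPolynomial.map (Int.castRingHom A) U = UA A := by
    intro A _
    simp only [U, UA, map_add, map_X, map_sum]
    congr 1
    refine Finset.sum_congr rfl fun k _ => ?_
    simp only [JZ, J, map_rename]
    rw [map_jointOut (Int.castRingHom A)]
  have h1T : 1 ≤ T := by omega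
  have hT26 : 1 ≤ T ^ 26 := Nat.one_le_pow _ _ h1T
  have hdT : d ≤ T := by omega
  -- the polynomial bounds per level
  have hlvl : ∀ k : Fin d, n + ((k : ℕ) + 1) + W + 1 ≤ 5 * T ^ 5 := fun k => by
    rw [hW, hs', ← hT]; exact universal_aux_le' k.isLt
  have hpow : ∀ k : Fin d, (n + ((k : ℕ) + 1) + W + 1) ^ 5 ≤ 3125 * T ^ 25 := fun k => by
    calc (n + ((k : ℕ) + 1) + W + 1) ^ 5 ≤ (5 * T ^ 5) ^ 5 := Nat.pow_le_pow_left (hlvl k) 5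
      _ = 3125 * T ^ 25 := by ring
  refine ⟨Fintype.card P, U, ?_, ?_, ?_, ?_, ?_⟩
  · -- parameter count
    have hP : Fintype.card P = 1 + ∑ k : Fin d, Fintype.card (L k) := by
      simp [P, Fintype.card_sum, Fintype.card_sigma]
    rw [hP]
    have hL : ∀ k : Fin d, Fintype.card (L k) ≤ 9375 * T ^ 25 := fun k => by
      calc Fintype.card (L k) ≤ 3 * (Fintype.card (Fin n) + ((k : ℕ) + 1) + W + 1) ^ 5 :=
            card_lab_le (Fin n) _ W
        _ = 3 * (n + ((k : ℕ) + 1) + W + 1) ^ 5 := by rw [Fintype.card_fin]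
        _ ≤ 3 * (3125 * T ^ 25) := Nat.mul_le_mul_left 3 (hpow k)
        _ = 9375 * T ^ 25 := by ring
    calc 1 + ∑ k : Fin d, Fintype.card (L k) ≤ 1 + ∑ _k : Fin d, 9375 * T ^ 25 := by
          gcongr with k; exact hL k
      _ = 1 + d * (9375 * T ^ 25) := by simp
      _ ≤ T ^ 26 + T * (9375 * T ^ 25) := by gcongr
      _ = 9376 * T ^ 26 := by ring
  · -- size
    have hJc : ∀ k : Fin d, complexity (JZ k) ≤ 21875 * T ^ 25 := fun k => by
      calc complexity (JZ k) ≤ complexity (jointOut ℤ (Fin n) ((k : ℕ) + 1) W) :=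
            complexity_rename_le_holds' _ _
        _ ≤ 7 * (n + ((k : ℕ) + 1) + W + 1) ^ 5 := complexity_jointOut_le_poly
        _ ≤ 7 * (3125 * T ^ 25) := Nat.mul_le_mul_left 7 (hpow k)
        _ = 21875 * T ^ 25 := by ring
    calc complexity U
        ≤ complexity (X (Sum.inr (e (Sum.inl ()))) : MvPolynomial (Fin n ⊕ Fin (Fintype.card P)) ℤ) +
            complexity (∑ k, JZ k) + 1 := complexity_add_le_holds _ _
      _ ≤ 0 + (∑ k, complexity (JZ k) + (Finset.univ : Finset (Fin d)).card) + 1 := by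
          rw [complexity_X_holds]
          gcongr
          exact complexity_finset_sum_le _ _
      _ ≤ 0 + (∑ _k : Fin d, 21875 * T ^ 25 + (Finset.univ : Finset (Fin d)).card) + 1 := by
          gcongr with k; exact hJc k
      _ = d * (21875 * T ^ 25) + d + 1 := by simp
      _ ≤ T * (21875 * T ^ 25) + T ^ 26 + T ^ 26 := by
          gcongr; exact hdT.trans (Nat.le_self_pow (by norm_num) T)
      _ = 21877 * T ^ 26 := by ring
  · -- degree in the inputs
    intro ex hex
    rcases Finset.mem_union.mp (support_add hex) with h1 | h1
    · change ex ∈ (monomial (Finsupp.single (Sum.inr (e (Sum.inl ()))) 1) (1 : ℤ)).support at h1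
      have hex1 := Finset.mem_singleton.mp (support_monomial_subset h1)
      subst hex1
      simp
    · obtain ⟨k, -, hk⟩ := Finset.mem_biUnion.mp (support_sum h1)
      simp only [JZ] at hk
      rw [support_rename_of_injective (hinj k)] at hk
      obtain ⟨e', he', rfl⟩ := Finset.mem_image.mp hk
      have hsum := sum_inl_eq_of_mem_support_jointOut (R := ℤ) he'
      calc ∑ i : Fin n, Finsupp.mapDomain (ι k) e' (Sum.inl i) = ∑ i : Fin n, e' (Sum.inl i) := by
            refine Finset.sum_congr rfl fun i _ => ?_
            have : (Sum.inl i : Fin n ⊕ Fin (Fintype.card P)) = ι k (Sum.inl i) := rfl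
            rw [this, Finsupp.mapDomain_apply (hinj k)]
        _ = (k : ℕ) + 1 := hsum
        _ ≤ d := k.isLt
  · -- total degree
    refine (totalDegree_add _ _).trans (max_le ((totalDegree_X_le_one' _).trans (by omega)) ?_)
    refine totalDegree_finsetSum_le fun k _ => (totalDegree_rename_le _ _).trans ?_
    refine (totalDegree_jointOut_le (R := ℤ) (σ := Fin n) (r := (k : ℕ) + 1) (N := W)).trans ?_
    have := k.isLt
    omega
  · -- universality, over an arbitrary commutative ring `R`
    intro R _ f hfd hfs
    have hlab : ∀ k : Fin d, ∃ y : L k → R, outVal y = homogeneousComponent ((k : ℕ) + 1) f := by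
      intro k
      have hk1 : 1 ≤ (k : ℕ) + 1 := by omega
      have hg : (homogeneousComponent ((k : ℕ) + 1) f).IsHomogeneous ((k : ℕ) + 1) :=
        homogeneousComponent_isHomogeneous _ _
      have hgc : complexity (homogeneousComponent ((k : ℕ) + 1) f) ≤ s' := by
        refine (complexity_homogeneousComponent_le_sq_mul f _).trans ?_
        rw [hs']
        have hk2 : ((k : ℕ) + 1 + 2) ^ 2 ≤ (d + 2) ^ 2 :=
          Nat.pow_le_pow_left (by have := k.isLt; omega) 2
        exact Nat.mul_le_mul hk2 hfs
      have hN : 4 * s' * ((k : ℕ) + 1 + 1) ^ 2 ≤ W := by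
        rw [hW]
        have hk2 : (k : ℕ) + 1 + 1 ≤ d + 1 := by have := k.isLt; omega
        exact Nat.mul_le_mul_left _ (Nat.pow_le_pow_left hk2 2)
      exact exists_labels_of_complexity_le (R := R) (σ := Fin n) (r := (k : ℕ) + 1) (N := W)
        hk1 hN hg hgc
    choose y hy using hlab
    let Y : P → R := Sum.elim (fun _ => coeff 0 f) (fun kl => y kl.1 kl.2)
    refine ⟨Y ∘ e.symm, ?_⟩
    rw [hmapU R]
    have hJ : ∀ k, aeval (Sum.elim X fun j => C ((Y ∘ e.symm) j)) (J R k) =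
        homogeneousComponent ((k : ℕ) + 1) f := by
      intro k
      simp only [J]
      rw [aeval_rename]
      have hfun : ((Sum.elim X fun j => C ((Y ∘ e.symm) j)) ∘ ι k :
          Fin n ⊕ L k → MvPolynomial (Fin n) R) = Sum.elim X fun l => C (y k l) := by
        funext v
        rcases v with t | l
        · rfl
        · simp [ι, Y]
      rw [hfun, aeval_labels_jointOut, hy]
    have hspec : aeval (Sum.elim X fun j => C ((Y ∘ e.symm) j)) (UA R) =
        C (coeff 0 f) + ∑ k : Fin d, homogeneousComponent ((k : ℕ) + 1) f := by
      simp only [UA]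
      rw [map_add, map_sum, aeval_X]
      congr 1
      · simp [Y]
      · exact Finset.sum_congr rfl fun k _ => hJ k
    rw [hspec, ← homogeneousComponent_zero]
    have hsub : Finset.range (f.totalDegree + 1) ⊆ Finset.range (d + 1) :=
      Finset.range_subset_range.mpr (by omega)
    calc homogeneousComponent 0 f + ∑ k : Fin d, homogeneousComponent ((k : ℕ) + 1) f
        = ∑ i ∈ Finset.range (d + 1), homogeneousComponent i f := by
          rw [Finset.sum_range_succ', Finset.sum_range]
          exact add_comm _ _
      _ = ∑ i ∈ Finset.range (f.totalDegree + 1), homogeneousComponent i f := by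
          refine (Finset.sum_subset hsub fun i _ hi' => ?_).symm
          apply homogeneousComponent_eq_zero
          simp only [Finset.mem_range] at hi'
          omega
      _ = f := sum_homogeneousComponent f

end Universal

end RazUniversal

end Literature.Computability.AlgebraicComplexity

end
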